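import Summits.CriticalPhenomena.PercolationContinuityZ3.Theorems.SahiMasterFamilyKahnModuleTensorClass

/-!
# Kahn's inequality for `(B ∧ U, C ∧ U')` and `(B ∨ U, C ∨ U')` with nested fresh `U ⊆ U'` — event form
# (lineage `prim-master-conj`, gen 56; `--supports stmt-CriticalPhenomena-4575`)

Theorems G8 (`kahnPair_tensor_nested`) and G9 (`kahnPair_bor_nested`) of `…KahnModuleTensor{,Or}` in the tree's vocabulary: coordinates
`S ⊕ T`, product measure `prodBernoulli p` on `Set (S ⊕ T)`; `B₀, C₀ ⊆ Set S` increasing events forming a Kahn pair for the product weight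
of `p ∘ inl` (e.g. any jointly module-peelable pair, `Peelable.kahnPair`), and `U ⊆ U' ⊆ Set T` NESTED increasing events on the fresh
coordinates.  Then for EVERY increasing `A ⊆ Set (S ⊕ T)`:
* `sahiE3_nonneg_and_nested`: `0 ≤ sahiE3 (prodBernoulli p) A (B₀ ∧ U) (C₀ ∧ U')`;
* `sahiE3_nonneg_or_nested`:  `0 ≤ sahiE3 (prodBernoulli p) A (B₀ ∨ U) (C₀ ∨ U')`,
where `B₀ ∧ U = {ω | inl⁻¹ ω ∈ B₀ ∧ inr⁻¹ ω ∈ U}` etc.  Nothing here asserts Kahn's Conjecture 5.  [this work]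
-/

open Finset
open scoped BigOperators

namespace Summit.CriticalPhenomena.PercolationContinuityZ3.Theorems.SahiKahnModule

open Literature.Combinatorics.Sahi2008 (bernoulliWeight monotone_ind_of_isUpperSet)
open Literature.Probability.LatticeModels (prodBernoulli sahiE3)
open Literature.Probability.Percolation.DecisionTree (ind ind_of_mem ind_of_not_mem ind_nonneg)

variable {S T : Type*} [Fintype S] [Fintype T]

omit [Fintype S] [Fintype T] in
/-- Bookkeeping: the conjunction event `B₀ ∧ U` of `Set (S ⊕ T)` pulled back along `Set.sumEquiv` is the tensor `1_{B₀} ⊗ 1_U`. [this work] -/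
theorem ind_and_comp_sumEquiv (B₀ : Set (Set S)) (U : Set (Set T)) :
    (liftX (ind B₀) * liftY (ind U)) ∘ (Set.sumEquiv : Set (S ⊕ T) ≃o _) =
      ind {ω : Set (S ⊕ T) | Sum.inl ⁻¹' ω ∈ B₀ ∧ Sum.inr ⁻¹' ω ∈ U} := by
  funext ω
  simp only [Function.comp_apply, Pi.mul_apply, liftX, liftY, Set.sumEquiv_apply]
  by_cases hb : Sum.inl ⁻¹' ω ∈ B₀ <;> by_cases hv : Sum.inr ⁻¹' ω ∈ U <;> simp [ind_of_mem, ind_of_not_mem, hb, hv]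

omit [Fintype S] [Fintype T] in
/-- Bookkeeping: the disjunction event `B₀ ∨ U` pulled back along `Set.sumEquiv` is `bor 1_{B₀} 1_U`. [this work] -/
theorem ind_or_comp_sumEquiv (B₀ : Set (Set S)) (U : Set (Set T)) :
    (bor (ind B₀) (ind U)) ∘ (Set.sumEquiv : Set (S ⊕ T) ≃o _) =
      ind {ω : Set (S ⊕ T) | Sum.inl ⁻¹' ω ∈ B₀ ∨ Sum.inr ⁻¹' ω ∈ U} := by
  funext ω
  simp only [Function.comp_apply, bor, Set.sumEquiv_apply]
  by_cases hb : Sum.inl ⁻¹' ω ∈ B₀ <;> by_cases hv : Sum.inr ⁻¹' ω ∈ U <;> simp [ind_of_mem, ind_of_not_mem, hb, hv]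

omit [Fintype T] in
/-- For nested events `U ⊆ U'`, the indicators are pointwise ordered. [this work] -/
theorem ind_le_ind_of_subset {U U' : Set (Set T)} (hUU : U ⊆ U') (y : Set T) : ind U y ≤ ind U' y := by
  by_cases hy : y ∈ U
  · rw [ind_of_mem hy, ind_of_mem (hUU hy)]
  · rw [ind_of_not_mem hy]; exact ind_nonneg U' y

/-- **`(B ∧ U, C ∧ U')` with nested fresh `U ⊆ U'` (THEOREM G8, event form).**  For a Kahn pair of increasing events `B₀, C₀ ⊆ Set S` and nested
increasing events `U ⊆ U' ⊆ Set T` on fresh coordinates, Kahn's inequality `0 ≤ sahiE3 (prodBernoulli p) A (B₀ ∧ U) (C₀ ∧ U')` holds for every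
increasing `A ⊆ Set (S ⊕ T)`. [this work] -/
theorem sahiE3_nonneg_and_nested (p : S ⊕ T → unitInterval) {B₀ C₀ : Set (Set S)} {U U' : Set (Set T)}
    (hB₀ : IsUpperSet B₀) (hC₀ : IsUpperSet C₀) (hU : IsUpperSet U) (hU' : IsUpperSet U') (hUU : U ⊆ U')
    (hK : KahnPair (bernoulliWeight (p ∘ Sum.inl)) (ind B₀) (ind C₀)) {A : Set (Set (S ⊕ T))} (hA : IsUpperSet A) :
    0 ≤ sahiE3 (prodBernoulli p) A {ω | Sum.inl ⁻¹' ω ∈ B₀ ∧ Sum.inr ⁻¹' ω ∈ U} {ω | Sum.inl ⁻¹' ω ∈ C₀ ∧ Sum.inr ⁻¹' ω ∈ U'} := by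
  have h1 := kahnPair_tensor_nested (isProbWeight_bernoulliWeight (p ∘ Sum.inl)) (isProbWeight_bernoulliWeight (p ∘ Sum.inr))
    (isHarris_bernoulliWeight (p ∘ Sum.inl)) (isHarris_bernoulliWeight (p ∘ Sum.inr)) (isIndicator_ind B₀) (isIndicator_ind C₀)
    (monotone_ind_of_isUpperSet hB₀) (monotone_ind_of_isUpperSet hC₀) (isIndicator_ind U) (isIndicator_ind U')
    (monotone_ind_of_isUpperSet hU) (monotone_ind_of_isUpperSet hU') (ind_le_ind_of_subset hUU) hK
  have h2 := kahnPair_bernoulliWeight_sum_of_kahnPair_prod p h1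
  rw [ind_and_comp_sumEquiv, ind_and_comp_sumEquiv] at h2
  exact sahiE3_nonneg_of_kahnPair p h2 hA

/-- **`(B ∨ U, C ∨ U')` with nested fresh `U ⊆ U'` (THEOREM G9, event form).**  For a Kahn pair of increasing events `B₀, C₀ ⊆ Set S` and nested
increasing events `U ⊆ U' ⊆ Set T` on fresh coordinates, Kahn's inequality `0 ≤ sahiE3 (prodBernoulli p) A (B₀ ∨ U) (C₀ ∨ U')` holds for every
increasing `A ⊆ Set (S ⊕ T)`. [this work] -/
theorem sahiE3_nonneg_or_nested (p : S ⊕ T → unitInterval) {B₀ C₀ : Set (Set S)} {U U' : Set (Set T)}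
    (hB₀ : IsUpperSet B₀) (hC₀ : IsUpperSet C₀) (hU : IsUpperSet U) (hU' : IsUpperSet U') (hUU : U ⊆ U')
    (hK : KahnPair (bernoulliWeight (p ∘ Sum.inl)) (ind B₀) (ind C₀)) {A : Set (Set (S ⊕ T))} (hA : IsUpperSet A) :
    0 ≤ sahiE3 (prodBernoulli p) A {ω | Sum.inl ⁻¹' ω ∈ B₀ ∨ Sum.inr ⁻¹' ω ∈ U} {ω | Sum.inl ⁻¹' ω ∈ C₀ ∨ Sum.inr ⁻¹' ω ∈ U'} := by
  have h1 := kahnPair_bor_nested (isProbWeight_bernoulliWeight (p ∘ Sum.inl)) (isProbWeight_bernoulliWeight (p ∘ Sum.inr))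
    (isHarris_bernoulliWeight (p ∘ Sum.inl)) (isHarris_bernoulliWeight (p ∘ Sum.inr)) (isIndicator_ind B₀) (isIndicator_ind C₀)
    (monotone_ind_of_isUpperSet hB₀) (monotone_ind_of_isUpperSet hC₀) (isIndicator_ind U) (isIndicator_ind U')
    (monotone_ind_of_isUpperSet hU) (monotone_ind_of_isUpperSet hU') (ind_le_ind_of_subset hUU) hK
  have h2 := kahnPair_bernoulliWeight_sum_of_kahnPair_prod p h1
  rw [ind_or_comp_sumEquiv, ind_or_comp_sumEquiv] at h2
  exact sahiE3_nonneg_of_kahnPair p h2 hA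

/-- **Peelable base, nested fresh OR-module**: for jointly module-peelable `(B₀, C₀)` the pair `(B₀ ∨ U, C₀ ∨ U')` satisfies Kahn's inequality for
every increasing `A` (a family outside the reach of `Peelable` itself when `U ≠ U'`). [this work] -/
theorem sahiE3_nonneg_or_nested_of_peelable (p : S ⊕ T → unitInterval) {B₀ C₀ : Set (Set S)} {U U' : Set (Set T)}
    (hB₀ : IsUpperSet B₀) (hC₀ : IsUpperSet C₀) (hU : IsUpperSet U) (hU' : IsUpperSet U') (hUU : U ⊆ U')
    (hP : Peelable (Set S) (bernoulliWeight (p ∘ Sum.inl)) (ind B₀) (ind C₀)) {A : Set (Set (S ⊕ T))} (hA : IsUpperSet A) :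
    0 ≤ sahiE3 (prodBernoulli p) A {ω | Sum.inl ⁻¹' ω ∈ B₀ ∨ Sum.inr ⁻¹' ω ∈ U} {ω | Sum.inl ⁻¹' ω ∈ C₀ ∨ Sum.inr ⁻¹' ω ∈ U'} :=
  sahiE3_nonneg_or_nested p hB₀ hC₀ hU hU' hUU hP.kahnPair hA

end Summit.CriticalPhenomena.PercolationContinuityZ3.Theorems.SahiKahnModule
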